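import Summits.BirchSwinnertonDyer.BirchSwinnertonDyer.Theorems.KolyvaginRoadThreeMethod2KolyvaginIsoBoundLocal
import Summits.BirchSwinnertonDyer.BirchSwinnertonDyer.Theorems.KolyvaginRoadThreeMethod2KolyvaginCupNonvanishing
import HarnessLib

/-!
# KOLY method line, crux stmt-BirchSwinnertonDyer-19574 `ZhangSharpFrameAtThreeHL`, stub S2-ENGINE: LOCAL LINE-RIGIDITY AT A
# KOLYVAGIN PRIME, II — the binder `hbound` of koly3b's (Supply) route, in cup-product currency
# (cell `bsd-stepL`, seat `bsd-stepL-zhang3-p1` g10; `--supports 19574`, helper)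

HONEST FRAMING. Theorems only; 0 definitions, 0 named facts, 0 `sorry`; local Galois cohomology at a Kolyvagin prime of
the Hoffstein–Luo frame (`K` imaginary quadratic with `c ≠ 1`, `ρ̄_{E,3}` onto); closes nothing (T7). PARTITION: O2@3
(B10) × A1 × crux 19574 × the S2-ENGINE's (Supply) binder `hbound` — proves-glue.

WHAT.
* `h1Eval_frob_eq_zero_of_cupProduct_self_eq_zero` — for a global `c`-eigenclass `x ∈ H¹(K, E[3])^{s}` NOT Selmer at
  the Kolyvagin place `λ` with `loc_λ x ∪ₑ loc_λ x = 0`, the value `[x, F]` at Gross's Frobenius lift `F` vanishes (the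
  local cocycle of `x` on `Γ_λ` satisfies the hypotheses of `apply_frob_eq_zero_of_self_cup_eq_zero`: Frobenius value in
  `E[3]^{s}`, inertia values in `E[3]^{-s}` — Gross Prop. 8.1 (1) —, ramified at the good place `λ`).
* `sub_zsmul_mem_torsionLocalKer_of_isotropic` — **`hbound`** of koly3b's `ZhangSupply.supply_signed_of_jump_bound`
  (p510108), per Kolyvagin prime and per Weil-type pairing, in cup-product currency (as (Perf) ∕ (Tr-iso) in
  `Method2.triangulation_of_kolyvaginLocal`, p508963): for `c`-eigenclasses `x, y ∈ H¹(K, E[3])^{s}` whose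
  `λ`-localisations span an ISOTROPIC subspace for the local Weil cup product (`x∪x = x∪y = y∪x = y∪y = 0`) and
  `loc_λ x ≠ 0`, `y - a • x ∈ torsionLocalKer_λ` for some `a ∈ ℤ` (`loc_λ y ∈ ℤ · loc_λ x`). Cases: `x` Selmer at `λ`
  ⟹ `y` Selmer (`mem_selmerLocalKer_of_cupProduct_eq_zero`) ⟹ both on the Kummer eigen-line (`exists_kummerEigenLine`);
  `x` not Selmer, `y` Selmer ⟹ `loc_λ y = 0` (`cupProduct_ne_zero_of_selmer_of_not_selmer`); both not Selmer ⟹ both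
  Frobenius values vanish (first bullet) and two ramified local cocycles vanishing at Frobenius with inertia values on
  the `(-s)`-eigen-line are proportional (`exists_eq_zsmul_of_apply_frob_eq_zero`, p523637).
With koly3b's reduction `hSupply ⟸ {hjump, hbound}` (p510108) and `hjump ⟸ poitouTate_selmerStructure_duality` (XVIII ∕
XXI ∕ XXII), this is the last LOCAL input of the S2-ENGINE's (Supply).
[cite: WZhang2014, Lemma 8.4, §8.1] [cite: GrossLMS1991, Prop. 8.1, 8.2, 9.6] [cite: McCallumLMS1991, Lemma 5.3]
-/

noncomputable section

open scoped Classical Pointwise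

namespace Summit.BirchSwinnertonDyer.Rank1Residual.X11b.Three.Koly.Method2.KolyLocal

open CategoryTheory WeierstrassCurve Field Function NumberField IsDedekindDomain
open Literature.NumberTheory.EllipticCurves Literature.NumberTheory.EllipticCurves.ModularForms
  Literature.NumberTheory.GaloisRepresentations Module
open Literature.NumberTheory.GaloisRepresentations.DiscreteGaloisModule (mu MuCarrier tateDual tateDualEval TateDual)
open Literature.NumberTheory.GaloisCohomology
open Summit.BirchSwinnertonDyer.Rank1Residual.X11b.Three.Koly.Method2
open Summit.BirchSwinnertonDyer.Rank1Residual.GaloisImage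
open scoped ContRepresentation

attribute [local instance] absoluteGaloisGroup_compactSpace
attribute [local instance] finite_geomTorsion_of_neZero

variable (W : WeierstrassCurve ℚ) (K : Type) [Field K] [NumberField K] [W.IsElliptic] [W.IsGloballyMinimal]

/-! ## §3 Global eigenclasses: the Frobenius value of a ramified class with isotropic self-cup-product vanishes -/

/-- **The Frobenius value of a ramified eigenclass with `loc_λ x ∪ₑ loc_λ x = 0` vanishes.** At a Kolyvagin prime
`λ ∋ ℓ` of the HL frame, with Gross's Frobenius-lift data at the prime `𝔓 ∣ λ` cut out by the chosen embedding
(`exists_frobeniusLift_of_isKolyvaginPrime`: the lift `t` of `c`, `h ∈ Γ_ℚ` inverting `μ₃`, the arithmetic Frobenius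
`F ∈ Γ_{K(E[3])}` at `𝔓` with `t⁻¹ F t = F`, `t² = 1` on `E[3]`): for `x ∈ H¹(K, E[3])^{s}` NOT Selmer at `λ` with
`loc_λ x ∪ₑ loc_λ x = 0`, `[x, F] = 0`. (The local cocycle of `x` on `Γ_λ` satisfies the hypotheses of
`apply_frob_eq_zero_of_self_cup_eq_zero`: Frobenius value in `E[3]^{s}` — `torsionMap_h1Eval_eq_of_conjAct_eq` —,
inertia values in `E[3]^{-s}` — Gross Prop. 8.1 (1), `torsionMap_h1Eval_inertia_eq_neg` —, ramified since `x` is not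
Selmer at the good place `λ`.) [cite: WZhang2014, Lemma 8.4 (1)] [cite: GrossLMS1991, Prop. 8.1, 8.2] -/
theorem h1Eval_frob_eq_zero_of_cupProduct_self_eq_zero (hK : IsImaginaryQuadratic K)
    (hsurj : W.HasSurjectiveModNGaloisRep 3) {c : K ≃ₐ[ℚ] K}
    (e : geomTorsion (W.baseChange K) ((3 ^ 1 : ℕ) : ℤ) → geomTorsion (W.baseChange K) ((3 ^ 1 : ℕ) : ℤ) →
      AlgebraicClosure K)
    (hμ : ∀ P Q, e P Q ^ (3 ^ 1) = 1) (hadd₁ : ∀ P₁ P₂ Q, e (P₁ + P₂) Q = e P₁ Q * e P₂ Q)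
    (hadd₂ : ∀ P Q₁ Q₂, e P (Q₁ + Q₂) = e P Q₁ * e P Q₂) (halt : ∀ Q, e Q Q = 1)
    (hnondeg : ∀ Q, (∀ P, e P Q = 1) → Q = 0)
    (hgal : ∀ (σ : absoluteGaloisGroup K) (P Q : geomTorsion (W.baseChange K) ((3 ^ 1 : ℕ) : ℤ)),
      σ • e P Q = e (σ • P) (σ • Q))
    {ℓ : ℕ} (hℓ : Zhang2014.IsKolyvaginPrime (W.conductorNorm ℤ) W K 3 ℓ) (v : HeightOneSpectrum (𝓞 K))
    (hv : (ℓ : 𝓞 K) ∈ v.asIdeal) {𝔐 : Ideal (HeightOneSpectrum.localAbsIntegers v)} (h𝔐 : 𝔐 ∈ v.localPrimesAbove)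
    {h : absoluteGaloisGroup ℚ} (ht : IsLiftOfAut c (absGaloisTransport (K := ℚ) (L := K) h).toRingEquiv)
    (hFrob : IsArithFrobAt (𝓞 ℚ) h
      ((v.primeBelow (closureEmb (K := K) (v.adicCompletion K)) 𝔐).comap (absIntegersMap ℚ K)))
    (hμinv : ∀ ζ : AlgebraicClosure ℚ, ζ ^ (3 ^ 1) = 1 → h • ζ = ζ⁻¹)
    {F : absoluteGaloisGroup K} (hF : IsArithFrobAt (𝓞 K) F (v.primeBelow (closureEmb (K := K) (v.adicCompletion K)) 𝔐))
    (hFT : F ∈ torsionFixing (W.baseChange K) ((3 ^ 1 : ℕ) : ℤ)) (hcF : ht.conjGalCMH F = F)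
    (htt : ∀ Q, ht.torsionMap W ((3 ^ 1 : ℕ) : ℤ) (ht.torsionMap W ((3 ^ 1 : ℕ) : ℤ) Q) = Q)
    {gF : absoluteGaloisGroup (v.adicCompletion K)} (hgF : absGaloisRestrict K (v.adicCompletion K) gF = F)
    (s : Bool) {x : V3 W K} (hxs : conjAct W c ((3 ^ 1 : ℕ) : ℤ) x = sgn s • x)
    (hxK : x ∉ selmerLocalKer (W.baseChange K) (v.adicCompletion K) ((3 ^ 1 : ℕ) : ℤ))
    (hxx : (weilContPairingLocal (W.baseChange K) (3 ^ 1) e hμ hadd₁ hadd₂ hgal (Sum.inr v)).cupProduct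
      (galoisCohomology.localization ((W.baseChange K).torsionGaloisModule ((3 ^ 1 : ℕ) : ℤ)) (Sum.inr v) 1 x)
      (galoisCohomology.localization ((W.baseChange K).torsionGaloisModule ((3 ^ 1 : ℕ) : ℤ)) (Sum.inr v) 1 x) = 0) :
    h1Eval (W.baseChange K) ((3 ^ 1 : ℕ) : ℤ) x F = 0 := by
  classical
  haveI : NeZero (3 ^ 1 : ℕ) := ⟨by norm_num⟩
  have hℓG := isKolyvaginPrime_three_of_zhang W K hK hsurj hℓ
  have hvw : v = hℓG.place := hℓG.mem_iff.mp hv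
  subst hvw
  obtain ⟨hgood, h3v⟩ := hasGoodReductionAt_of_kolyvagin W K hℓ hℓG.place hv
  have hvbad : hℓG.place ∉ (W.baseChange K).badPlaces (𝓞 K) := fun h ↦ h hgood
  have h𝔓 : hℓG.place.primeBelow (closureEmb (K := K) (hℓG.place.adicCompletion K)) 𝔐 ∈ hℓG.place.primesAbove :=
    HeightOneSpectrum.primeBelow_mem_primesAbove h𝔐
  -- ### `Γ_λ` fixes `E[3]`
  have hD : ∀ d ∈ (hℓG.place.primeBelow (closureEmb (K := K) (hℓG.place.adicCompletion K)) 𝔐).decompositionSubgroup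
      (absoluteGaloisGroup K), d ∈ torsionFixing (W.baseChange K) ((3 ^ 1 : ℕ) : ℤ) := fun d hd ↦
    decompositionSubgroup_le_torsionFixing W K hK hℓ hℓG.place hv h𝔐 hd
  have hres : ∀ g : absoluteGaloisGroup (hℓG.place.adicCompletion K),
      absGaloisRestrict K (hℓG.place.adicCompletion K) g ∈ (hℓG.place.primeBelow (closureEmb (K := K)
        (hℓG.place.adicCompletion K)) 𝔐).decompositionSubgroup (absoluteGaloisGroup K) := fun g ↦ by
    rw [← resGal_eq_absGaloisRestrict, resGal_eq]; exact resGalOfEmb_mem_decompositionSubgroup _ h𝔐 g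
  have hfixA : ∀ (g : absoluteGaloisGroup (hℓG.place.adicCompletion K))
      (Q : geomTorsion (W.baseChange K) ((3 ^ 1 : ℕ) : ℤ)), absGaloisRestrict K (hℓG.place.adicCompletion K) g • Q = Q :=
    fun g Q ↦ smul_eq_of_mem_torsionFixing (W.baseChange K) _ (hD _ (hres g)) Q
  -- ### the cocycle of `x` and its local pullback `fx` on `Γ_λ`
  obtain ⟨φx, hφx⟩ : ∃ φ, φ = reprCocycle (W.baseChange K) ((3 ^ 1 : ℕ) : ℤ) x := ⟨_, rfl⟩
  obtain ⟨fx, hfxdef⟩ : ∃ f : contOneCocycles ((DiscreteGaloisModule.toLocal ((W.baseChange K).torsionGaloisModule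
      ((3 ^ 1 : ℕ) : ℤ)) (Sum.inr hℓG.place)).toTopRep),
      f = contOneCocycles.pullback (absGaloisRestrict K (hℓG.place.adicCompletion K))
        (X := discreteTopRep (absoluteGaloisGroup K) (geomTorsion (W.baseChange K) ((3 ^ 1 : ℕ) : ℤ)))
        (Y := (DiscreteGaloisModule.toLocal ((W.baseChange K).torsionGaloisModule ((3 ^ 1 : ℕ) : ℤ))
          (Sum.inr hℓG.place)).toTopRep)
        (TopRep.ofHom ⟨ContinuousLinearMap.id ℤ (geomTorsion (W.baseChange K) ((3 ^ 1 : ℕ) : ℤ)), fun _ => rfl⟩) φx :=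
    ⟨_, rfl⟩
  have hfx : ∀ g, fx.1 g = φx.1 (absGaloisRestrict K (hℓG.place.adicCompletion K) g) := fun g ↦ by rw [hfxdef]; rfl
  have hlocx : galoisCohomology.localization ((W.baseChange K).torsionGaloisModule ((3 ^ 1 : ℕ) : ℤ))
      (Sum.inr hℓG.place) 1 x = oneCocycleClass ((DiscreteGaloisModule.toLocal ((W.baseChange K).torsionGaloisModule
        ((3 ^ 1 : ℕ) : ℤ)) (Sum.inr hℓG.place)).toTopRep) fx := by
    rw [← oneCocycleClass_reprCocycle (W.baseChange K) ((3 ^ 1 : ℕ) : ℤ) x, hfxdef, hφx]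
    exact res_torsionGaloisModule_oneCocycleClass (W.baseChange K) ((3 ^ 1 : ℕ) : ℤ) (hℓG.place.adicCompletion K) _
  have hPφ : h1Eval (W.baseChange K) ((3 ^ 1 : ℕ) : ℤ) x F = φx.1 F := by rw [hφx]; rfl
  have hfxF : fx.1 gF = h1Eval (W.baseChange K) ((3 ^ 1 : ℕ) : ℤ) x F := by rw [hfx, hgF, hPφ]
  -- ### the sign laws: `[x, F] ∈ E[3]^{s}`, inertia values in `E[3]^{-s}` (Gross Prop. 8.1 (1))
  have hν : sgn s = 1 ∨ sgn s = -1 := by cases s <;> simp [sgn]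
  have hPν : ht.torsionMap W ((3 ^ 1 : ℕ) : ℤ) (fx.1 gF) = sgn s • fx.1 gF := by
    rw [hfxF]; exact torsionMap_h1Eval_eq_of_conjAct_eq W ht _ hFT hcF hxs
  have hIν : ∀ g, absGaloisRestrict K (hℓG.place.adicCompletion K) g ∈
      (hℓG.place.primeBelow (closureEmb (K := K) (hℓG.place.adicCompletion K)) 𝔐).inertia (absoluteGaloisGroup K) →
      ht.torsionMap W ((3 ^ 1 : ℕ) : ℤ) (fx.1 g) = -(sgn s • fx.1 g) := fun g hg ↦ by
    rw [hfx, hφx]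
    exact torsionMap_h1Eval_inertia_eq_neg W (p := 3 ^ 1) (by norm_num) hℓG hvbad h𝔓 ht hFrob hμinv hxs hg
  -- ### `x` is ramified at `λ`: an inertia element with non-zero value, lifted to `Γ_λ`
  obtain ⟨i, hiI, hQ0⟩ : ∃ i ∈ (hℓG.place.primeBelow (closureEmb (K := K) (hℓG.place.adicCompletion K)) 𝔐).inertia
      (absoluteGaloisGroup K), φx.1 i ≠ 0 := by
    by_contra hall
    push Not at hall
    apply hxK
    rw [← oneCocycleClass_reprCocycle (W.baseChange K) ((3 ^ 1 : ℕ) : ℤ) x, ← hφx]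
    exact ((W.baseChange K).oneCocycleClass_mem_selmerLocalKer_iff hgood h3v h𝔓 φx).mpr hall
  obtain ⟨gi, hgi⟩ := exists_absGaloisRestrict_eq_of_mem_decompositionSubgroup K hℓG.place h𝔐
    (Ideal.inertia_le_stabilizer _ hiI)
  have hram : ∃ g, absGaloisRestrict K (hℓG.place.adicCompletion K) g ∈
      (hℓG.place.primeBelow (closureEmb (K := K) (hℓG.place.adicCompletion K)) 𝔐).inertia (absoluteGaloisGroup K) ∧
      fx.1 g ≠ 0 := ⟨gi, by rw [hgi]; exact hiI, by rw [hfx, hgi]; exact hQ0⟩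
  -- ### `[fx ∪ fx] = 0` in cocycle currency, and the local theorem
  have hxx' : twoCocycleClass _ ((weilContPairingLocal (W.baseChange K) (3 ^ 1) e hμ hadd₁ hadd₂ hgal
      (Sum.inr hℓG.place)).cupCocycle fx fx) = 0 := by
    rw [← ContPairing.cupProduct_oneCocycleClass_eq_twoCocycleClass, ← hlocx]
    exact hxx
  have key := apply_frob_eq_zero_of_self_cup_eq_zero W K hK hsurj e hμ hadd₁ hadd₂ halt hnondeg hgal hℓ hℓG.place hv
    h𝔐 hF hgF (ht.torsionMap W ((3 ^ 1 : ℕ) : ℤ)) htt hν fx hPν hIν hram hxx'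
  rw [hfxF] at key
  exact key

/-! ## §4 `hbound`: isotropic pairs of eigenclasses are proportional at a Kolyvagin prime -/

/-- **Local line-rigidity at a Kolyvagin prime (`hbound` of koly3b's `ZhangSupply.supply_signed_of_jump_bound`, in
cup-product currency).** At a Kolyvagin prime `λ ∋ ℓ` of the HL frame (`K` imaginary quadratic with `c ≠ 1`,
`ρ̄_{E,3}` onto), for every Weil-type pairing `e` on `E[3]` and each sign `s`: if `x, y ∈ H¹(K, E[3])^{s}` have
`λ`-localisations spanning an isotropic subspace for the local Weil cup product (`x ∪ x = x ∪ y = y ∪ x = y ∪ y = 0`) and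
`loc_λ x ≠ 0`, then `y - a • x ∈ torsionLocalKer_λ` for some `a ∈ ℤ` (`loc_λ y ∈ ℤ · loc_λ x`). Cases: `x` Selmer at
`λ` (then `y` is, and both lie on the Kummer eigen-line); `x` not Selmer, `y` Selmer (then `loc_λ y = 0`); both not
Selmer (both Frobenius values vanish, and two ramified cocycles vanishing at Frobenius with inertia values on the
`(-s)`-eigen-line are proportional). [cite: WZhang2014, Lemma 8.4 (1), §8.1] [cite: GrossLMS1991, Prop. 8.1, 8.2, 9.6]
[cite: McCallumLMS1991, Lemma 5.3] -/
theorem sub_zsmul_mem_torsionLocalKer_of_isotropic (hK : IsImaginaryQuadratic K)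
    (hsurj : W.HasSurjectiveModNGaloisRep 3) {c : K ≃ₐ[ℚ] K} (hc : c ≠ 1)
    (e : geomTorsion (W.baseChange K) ((3 ^ 1 : ℕ) : ℤ) → geomTorsion (W.baseChange K) ((3 ^ 1 : ℕ) : ℤ) →
      AlgebraicClosure K)
    (hμ : ∀ P Q, e P Q ^ (3 ^ 1) = 1) (hadd₁ : ∀ P₁ P₂ Q, e (P₁ + P₂) Q = e P₁ Q * e P₂ Q)
    (hadd₂ : ∀ P Q₁ Q₂, e P (Q₁ + Q₂) = e P Q₁ * e P Q₂) (halt : ∀ Q, e Q Q = 1)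
    (hnondeg : ∀ Q, (∀ P, e P Q = 1) → Q = 0)
    (hgal : ∀ (σ : absoluteGaloisGroup K) (P Q : geomTorsion (W.baseChange K) ((3 ^ 1 : ℕ) : ℤ)),
      σ • e P Q = e (σ • P) (σ • Q))
    {ℓ : ℕ} (hℓ : Zhang2014.IsKolyvaginPrime (W.conductorNorm ℤ) W K 3 ℓ) (v : HeightOneSpectrum (𝓞 K))
    (hv : (ℓ : 𝓞 K) ∈ v.asIdeal) (s : Bool) {x y : V3 W K}
    (hxs : conjAct W c ((3 ^ 1 : ℕ) : ℤ) x = sgn s • x) (hys : conjAct W c ((3 ^ 1 : ℕ) : ℤ) y = sgn s • y)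
    (hxx : (weilContPairingLocal (W.baseChange K) (3 ^ 1) e hμ hadd₁ hadd₂ hgal (Sum.inr v)).cupProduct
      (galoisCohomology.localization ((W.baseChange K).torsionGaloisModule ((3 ^ 1 : ℕ) : ℤ)) (Sum.inr v) 1 x)
      (galoisCohomology.localization ((W.baseChange K).torsionGaloisModule ((3 ^ 1 : ℕ) : ℤ)) (Sum.inr v) 1 x) = 0)
    (hxy : (weilContPairingLocal (W.baseChange K) (3 ^ 1) e hμ hadd₁ hadd₂ hgal (Sum.inr v)).cupProduct
      (galoisCohomology.localization ((W.baseChange K).torsionGaloisModule ((3 ^ 1 : ℕ) : ℤ)) (Sum.inr v) 1 x)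
      (galoisCohomology.localization ((W.baseChange K).torsionGaloisModule ((3 ^ 1 : ℕ) : ℤ)) (Sum.inr v) 1 y) = 0)
    (hyx : (weilContPairingLocal (W.baseChange K) (3 ^ 1) e hμ hadd₁ hadd₂ hgal (Sum.inr v)).cupProduct
      (galoisCohomology.localization ((W.baseChange K).torsionGaloisModule ((3 ^ 1 : ℕ) : ℤ)) (Sum.inr v) 1 y)
      (galoisCohomology.localization ((W.baseChange K).torsionGaloisModule ((3 ^ 1 : ℕ) : ℤ)) (Sum.inr v) 1 x) = 0)
    (hyy : (weilContPairingLocal (W.baseChange K) (3 ^ 1) e hμ hadd₁ hadd₂ hgal (Sum.inr v)).cupProduct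
      (galoisCohomology.localization ((W.baseChange K).torsionGaloisModule ((3 ^ 1 : ℕ) : ℤ)) (Sum.inr v) 1 y)
      (galoisCohomology.localization ((W.baseChange K).torsionGaloisModule ((3 ^ 1 : ℕ) : ℤ)) (Sum.inr v) 1 y) = 0)
    (hx0 : x ∉ (W.baseChange K).torsionLocalKer (v.adicCompletion K) ((3 ^ 1 : ℕ) : ℤ)) :
    ∃ a : ℤ, y - a • x ∈ (W.baseChange K).torsionLocalKer (v.adicCompletion K) ((3 ^ 1 : ℕ) : ℤ) := by
  classical
  haveI : NeZero (3 ^ 1 : ℕ) := ⟨by norm_num⟩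
  haveI : Fact (Nat.Prime 3) := ⟨Nat.prime_three⟩
  have hker := fun z ↦ mem_torsionLocalKer_iff_localization_eq_zero W K v z
  have hsub : ∀ a : ℤ, galoisCohomology.localization ((W.baseChange K).torsionGaloisModule ((3 ^ 1 : ℕ) : ℤ))
      (Sum.inr v) 1 (y - a • x) = galoisCohomology.localization ((W.baseChange K).torsionGaloisModule
        ((3 ^ 1 : ℕ) : ℤ)) (Sum.inr v) 1 y - a • galoisCohomology.localization ((W.baseChange K).torsionGaloisModule
          ((3 ^ 1 : ℕ) : ℤ)) (Sum.inr v) 1 x := fun a ↦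
    (map_sub (galoisCohomology.localization ((W.baseChange K).torsionGaloisModule ((3 ^ 1 : ℕ) : ℤ)) (Sum.inr v) 1)
      y (a • x)).trans (congrArg (fun z ↦ _ - z) (map_zsmul (galoisCohomology.localization
        ((W.baseChange K).torsionGaloisModule ((3 ^ 1 : ℕ) : ℤ)) (Sum.inr v) 1) a x))
  by_cases hxK : x ∈ selmerLocalKer (W.baseChange K) (v.adicCompletion K) ((3 ^ 1 : ℕ) : ℤ)
  · -- ### Case A: `x` Selmer at `λ`; then `y` is Selmer too and both lie on the Kummer eigen-line
    have hyK := mem_selmerLocalKer_of_cupProduct_eq_zero W K hK hsurj hc e hμ hadd₁ hadd₂ halt hnondeg hgal hℓ v hv s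
      hxs hys hxK hx0 hxy
    obtain ⟨e', he'⟩ := exists_kummerEigenLine W K hK hsurj hc hℓ v hv s
    obtain ⟨a, ha⟩ := he' x hxs hxK
    obtain ⟨b, hb⟩ := he' y hys hyK
    have h3e : (3 : ℤ) • e' = 0 := by
      have h := galoisCohomology.nsmul_eq_zero_of_forall (((W.baseChange K).torsionGaloisModule ((3 ^ 1 : ℕ) :
        ℤ)).toLocal (Sum.inr v)) (n := 3 ^ 1) (fun m => AddSubgroup.torsionBy.nsmul m) e'
      rw [← natCast_zsmul] at h
      exact_mod_cast h
    have h3a : ¬ (3 : ℤ) ∣ a := by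
      rintro ⟨k, rfl⟩
      apply hx0
      rw [hker, ha, mul_zsmul', h3e, zsmul_zero]
    obtain ⟨k, hk⟩ : (3 : ℤ) ∣ 1 - a * a := by
      have h0 : a % 3 ≠ 0 := fun h0 ↦ h3a (Int.dvd_of_emod_eq_zero h0)
      have h1 : 0 ≤ a % 3 := Int.emod_nonneg a (by norm_num)
      have h2 : a % 3 < 3 := Int.emod_lt_of_pos a (by norm_num)
      rw [Int.dvd_iff_emod_eq_zero, Int.sub_emod, Int.mul_emod]
      interval_cases hmod : (a % 3)
      · exact absurd rfl h0
      · decide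
      · decide
    refine ⟨b * a, (hker _).mpr ?_⟩
    have hba : b - b * a * a = b * k * 3 := by linear_combination b * hk
    rw [hsub, ha, hb, ← mul_zsmul, sub_eq_add_neg, ← sub_zsmul, hba, mul_zsmul e' (b * k) 3, h3e, zsmul_zero]
  by_cases hyK : y ∈ selmerLocalKer (W.baseChange K) (v.adicCompletion K) ((3 ^ 1 : ℕ) : ℤ)
  · -- ### Case B: `x` ramified, `y` Selmer at `λ`; then `loc_λ y = 0`
    refine ⟨0, ?_⟩
    rw [zero_zsmul, sub_zero]
    by_contra hy0
    exact cupProduct_ne_zero_of_selmer_of_not_selmer W K hK hsurj hc e hμ hadd₁ hadd₂ halt hnondeg hgal hℓ v hv s hys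
      hxs hyK hy0 hxK hyx
  -- ### Case C: both ramified at `λ`
  have hℓG := isKolyvaginPrime_three_of_zhang W K hK hsurj hℓ
  have hvw : v = hℓG.place := hℓG.mem_iff.mp hv
  subst hvw
  obtain ⟨hgood, h3v⟩ := hasGoodReductionAt_of_kolyvagin W K hℓ hℓG.place hv
  have hvbad : hℓG.place ∉ (W.baseChange K).badPlaces (𝓞 K) := fun h ↦ h hgood
  obtain ⟨𝔐, h𝔐⟩ := hℓG.place.localPrimesAbove_nonempty
  have h𝔓 : hℓG.place.primeBelow (closureEmb (K := K) (hℓG.place.adicCompletion K)) 𝔐 ∈ hℓG.place.primesAbove :=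
    HeightOneSpectrum.primeBelow_mem_primesAbove h𝔐
  -- Gross's Frobenius lift at `𝔓`
  obtain ⟨h, c₀, F, ht, -, -, hμinv, hFrob, hF, -, hFT, hcF, htt, ⟨Qp, hQp0, hQp⟩, ⟨Qm, hQm0, hQm⟩, -⟩ :=
    exists_frobeniusLift_of_isKolyvaginPrime W hK (p := 3 ^ 1) (by norm_num) (by norm_num) hc hℓG h𝔓
  have hFT' : F ∈ torsionFixing (W.baseChange K) ((3 ^ 1 : ℕ) : ℤ) := hFT
  haveI := h𝔓.1
  obtain ⟨gF, hgF⟩ := exists_absGaloisRestrict_eq_of_mem_decompositionSubgroup K hℓG.place h𝔐 hF.mem_stabilizer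
  -- both Frobenius values vanish
  have hxF := h1Eval_frob_eq_zero_of_cupProduct_self_eq_zero W K hK hsurj e hμ hadd₁ hadd₂ halt hnondeg hgal hℓ
    hℓG.place hv h𝔐 ht hFrob hμinv hF hFT' hcF htt hgF s hxs hxK hxx
  have hyF := h1Eval_frob_eq_zero_of_cupProduct_self_eq_zero W K hK hsurj e hμ hadd₁ hadd₂ halt hnondeg hgal hℓ
    hℓG.place hv h𝔐 ht hFrob hμinv hF hFT' hcF htt hgF s hys hyK hyy
  -- ### `Γ_λ` fixes `E[3]`; the local cocycles `fx, fy`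
  have hD : ∀ d ∈ (hℓG.place.primeBelow (closureEmb (K := K) (hℓG.place.adicCompletion K)) 𝔐).decompositionSubgroup
      (absoluteGaloisGroup K), d ∈ torsionFixing (W.baseChange K) ((3 ^ 1 : ℕ) : ℤ) := fun d hd ↦
    decompositionSubgroup_le_torsionFixing W K hK hℓ hℓG.place hv h𝔐 hd
  have hres : ∀ g : absoluteGaloisGroup (hℓG.place.adicCompletion K),
      absGaloisRestrict K (hℓG.place.adicCompletion K) g ∈ (hℓG.place.primeBelow (closureEmb (K := K)
        (hℓG.place.adicCompletion K)) 𝔐).decompositionSubgroup (absoluteGaloisGroup K) := fun g ↦ by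
    rw [← resGal_eq_absGaloisRestrict, resGal_eq]; exact resGalOfEmb_mem_decompositionSubgroup _ h𝔐 g
  have hfixA : ∀ (g : absoluteGaloisGroup (hℓG.place.adicCompletion K))
      (Q : geomTorsion (W.baseChange K) ((3 ^ 1 : ℕ) : ℤ)), absGaloisRestrict K (hℓG.place.adicCompletion K) g • Q = Q :=
    fun g Q ↦ smul_eq_of_mem_torsionFixing (W.baseChange K) _ (hD _ (hres g)) Q
  have hpT : ∀ Q : geomTorsion (W.baseChange K) ((3 ^ 1 : ℕ) : ℤ), 3 • Q = 0 := fun Q ↦ by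
    have := (mem_geomTorsion_iff (W.baseChange K) ((3 ^ 1 : ℕ) : ℤ) _).mp Q.2
    apply Subtype.ext
    rw [AddSubgroupClass.coe_nsmul, ← natCast_zsmul]
    exact this
  have hcard : Nat.card (geomTorsion (W.baseChange K) ((3 ^ 1 : ℕ) : ℤ)) = 3 ^ 2 :=
    card_torsionPoints_eq_sq_holds (W.baseChange K) (AlgebraicClosure K) (n := 3) (by norm_num)
  obtain ⟨φx, hφx⟩ : ∃ φ, φ = reprCocycle (W.baseChange K) ((3 ^ 1 : ℕ) : ℤ) x := ⟨_, rfl⟩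
  obtain ⟨φy, hφy⟩ : ∃ φ, φ = reprCocycle (W.baseChange K) ((3 ^ 1 : ℕ) : ℤ) y := ⟨_, rfl⟩
  obtain ⟨fx, hfxdef⟩ : ∃ f : contOneCocycles ((DiscreteGaloisModule.toLocal ((W.baseChange K).torsionGaloisModule
      ((3 ^ 1 : ℕ) : ℤ)) (Sum.inr hℓG.place)).toTopRep),
      f = contOneCocycles.pullback (absGaloisRestrict K (hℓG.place.adicCompletion K))
        (X := discreteTopRep (absoluteGaloisGroup K) (geomTorsion (W.baseChange K) ((3 ^ 1 : ℕ) : ℤ)))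
        (Y := (DiscreteGaloisModule.toLocal ((W.baseChange K).torsionGaloisModule ((3 ^ 1 : ℕ) : ℤ))
          (Sum.inr hℓG.place)).toTopRep)
        (TopRep.ofHom ⟨ContinuousLinearMap.id ℤ (geomTorsion (W.baseChange K) ((3 ^ 1 : ℕ) : ℤ)), fun _ => rfl⟩) φx :=
    ⟨_, rfl⟩
  obtain ⟨fy, hfydef⟩ : ∃ f : contOneCocycles ((DiscreteGaloisModule.toLocal ((W.baseChange K).torsionGaloisModule
      ((3 ^ 1 : ℕ) : ℤ)) (Sum.inr hℓG.place)).toTopRep),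
      f = contOneCocycles.pullback (absGaloisRestrict K (hℓG.place.adicCompletion K))
        (X := discreteTopRep (absoluteGaloisGroup K) (geomTorsion (W.baseChange K) ((3 ^ 1 : ℕ) : ℤ)))
        (Y := (DiscreteGaloisModule.toLocal ((W.baseChange K).torsionGaloisModule ((3 ^ 1 : ℕ) : ℤ))
          (Sum.inr hℓG.place)).toTopRep)
        (TopRep.ofHom ⟨ContinuousLinearMap.id ℤ (geomTorsion (W.baseChange K) ((3 ^ 1 : ℕ) : ℤ)), fun _ => rfl⟩) φy :=
    ⟨_, rfl⟩
  have hfx : ∀ g, fx.1 g = φx.1 (absGaloisRestrict K (hℓG.place.adicCompletion K) g) := fun g ↦ by rw [hfxdef]; rfl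
  have hfy : ∀ g, fy.1 g = φy.1 (absGaloisRestrict K (hℓG.place.adicCompletion K) g) := fun g ↦ by rw [hfydef]; rfl
  have hlocx : galoisCohomology.localization ((W.baseChange K).torsionGaloisModule ((3 ^ 1 : ℕ) : ℤ))
      (Sum.inr hℓG.place) 1 x = oneCocycleClass ((DiscreteGaloisModule.toLocal ((W.baseChange K).torsionGaloisModule
        ((3 ^ 1 : ℕ) : ℤ)) (Sum.inr hℓG.place)).toTopRep) fx := by
    rw [← oneCocycleClass_reprCocycle (W.baseChange K) ((3 ^ 1 : ℕ) : ℤ) x, hfxdef, hφx]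
    exact res_torsionGaloisModule_oneCocycleClass (W.baseChange K) ((3 ^ 1 : ℕ) : ℤ) (hℓG.place.adicCompletion K) _
  have hlocy : galoisCohomology.localization ((W.baseChange K).torsionGaloisModule ((3 ^ 1 : ℕ) : ℤ))
      (Sum.inr hℓG.place) 1 y = oneCocycleClass ((DiscreteGaloisModule.toLocal ((W.baseChange K).torsionGaloisModule
        ((3 ^ 1 : ℕ) : ℤ)) (Sum.inr hℓG.place)).toTopRep) fy := by
    rw [← oneCocycleClass_reprCocycle (W.baseChange K) ((3 ^ 1 : ℕ) : ℤ) y, hfydef, hφy]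
    exact res_torsionGaloisModule_oneCocycleClass (W.baseChange K) ((3 ^ 1 : ℕ) : ℤ) (hℓG.place.adicCompletion K) _
  have hfx_add : ∀ g g', fx.1 (g * g') = fx.1 g + fx.1 g' := fun g g' ↦
    (fx.2 g g').trans (congrArg (fun Q ↦ fx.1 g + Q) (hfixA g (fx.1 g')))
  have hfy_add : ∀ g g', fy.1 (g * g') = fy.1 g + fy.1 g' := fun g g' ↦
    (fy.2 g g').trans (congrArg (fun Q ↦ fy.1 g + Q) (hfixA g (fy.1 g')))
  have hfxF : fx.1 gF = 0 := by rw [hfx, hgF, ← hxF, hφx]; rfl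
  have hfyF : fy.1 gF = 0 := by rw [hfy, hgF, ← hyF, hφy]; rfl
  -- ### the inertia eigen-line `ℤ Q`, `Q = [x, i] ≠ 0`
  obtain ⟨i, hiI, hQ0⟩ : ∃ i ∈ (hℓG.place.primeBelow (closureEmb (K := K) (hℓG.place.adicCompletion K)) 𝔐).inertia
      (absoluteGaloisGroup K), φx.1 i ≠ 0 := by
    by_contra hall
    push Not at hall
    apply hxK
    rw [← oneCocycleClass_reprCocycle (W.baseChange K) ((3 ^ 1 : ℕ) : ℤ) x, ← hφx]
    exact ((W.baseChange K).oneCocycleClass_mem_selmerLocalKer_iff hgood h3v h𝔓 φx).mpr hall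
  have hν : sgn s = 1 ∨ sgn s = -1 := by cases s <;> simp [sgn]
  have hν' : -sgn s = 1 ∨ -sgn s = -1 := by rcases hν with h1 | h1 <;> simp [h1]
  obtain ⟨P, hP0, hP⟩ : ∃ P : geomTorsion (W.baseChange K) ((3 ^ 1 : ℕ) : ℤ), P ≠ 0 ∧
      ht.torsionMap W ((3 ^ 1 : ℕ) : ℤ) P = sgn s • P := by
    cases s
    · exact ⟨Qm, hQm0, by rw [show sgn false = -1 from rfl, neg_one_zsmul]; exact hQm⟩
    · exact ⟨Qp, hQp0, by rw [show sgn true = 1 from rfl, one_zsmul]; exact hQp⟩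
  have hQs : ht.torsionMap W ((3 ^ 1 : ℕ) : ℤ) (φx.1 i) = -(sgn s • φx.1 i) := by
    rw [hφx]
    exact torsionMap_h1Eval_inertia_eq_neg W (p := 3 ^ 1) (by norm_num) hℓG hvbad h𝔓 ht hFrob hμinv hxs hiI
  have hEm : ∀ a, ht.torsionMap W ((3 ^ 1 : ℕ) : ℤ) a = -(sgn s • a) → a ∈ AddSubgroup.zmultiples (φx.1 i) :=
    fun a ha ↦ mem_zmultiples_of_eigen_of_eigen Nat.prime_three (by norm_num) hcard hpT (ht.torsionMap W _) hν' hQ0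
      (by rw [neg_smul]; exact hQs) hP0 (by rw [neg_smul, neg_neg]; exact hP) (by rw [neg_smul]; exact ha)
  have hxI : ∀ g, absGaloisRestrict K (hℓG.place.adicCompletion K) g ∈
      (hℓG.place.primeBelow (closureEmb (K := K) (hℓG.place.adicCompletion K)) 𝔐).inertia (absoluteGaloisGroup K) →
      ht.torsionMap W ((3 ^ 1 : ℕ) : ℤ) (fx.1 g) = -(sgn s • fx.1 g) := fun g hg ↦ by
    rw [hfx, hφx]
    exact torsionMap_h1Eval_inertia_eq_neg W (p := 3 ^ 1) (by norm_num) hℓG hvbad h𝔓 ht hFrob hμinv hxs hg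
  have hyI : ∀ g, absGaloisRestrict K (hℓG.place.adicCompletion K) g ∈
      (hℓG.place.primeBelow (closureEmb (K := K) (hℓG.place.adicCompletion K)) 𝔐).inertia (absoluteGaloisGroup K) →
      ht.torsionMap W ((3 ^ 1 : ℕ) : ℤ) (fy.1 g) = -(sgn s • fy.1 g) := fun g hg ↦ by
    rw [hfy, hφy]
    exact torsionMap_h1Eval_inertia_eq_neg W (p := 3 ^ 1) (by norm_num) hℓG hvbad h𝔓 ht hFrob hμinv hys hg
  have hfI : ∀ g, absGaloisRestrict K (hℓG.place.adicCompletion K) g ∈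
      (hℓG.place.primeBelow (closureEmb (K := K) (hℓG.place.adicCompletion K)) 𝔐).inertia (absoluteGaloisGroup K) →
      fx.1 g ∈ AddSubgroup.zmultiples (φx.1 i) ∧ fy.1 g ∈ AddSubgroup.zmultiples (φx.1 i) := fun g hg ↦
    ⟨hEm _ (hxI g hg), hEm _ (hyI g hg)⟩
  obtain ⟨gi, hgi⟩ := exists_absGaloisRestrict_eq_of_mem_decompositionSubgroup K hℓG.place h𝔐
    (Ideal.inertia_le_stabilizer _ hiI)
  have hram : ∃ g, absGaloisRestrict K (hℓG.place.adicCompletion K) g ∈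
      (hℓG.place.primeBelow (closureEmb (K := K) (hℓG.place.adicCompletion K)) 𝔐).inertia (absoluteGaloisGroup K) ∧
      fx.1 g ≠ 0 := ⟨gi, by rw [hgi]; exact hiI, by rw [hfx, hgi]; exact hQ0⟩
  -- ### two ramified cocycles vanishing at Frobenius with inertia values on one line are proportional
  have h3v' : ((3 ^ 1 : ℕ) : 𝓞 K) ∉ hℓG.place.asIdeal := by
    have := h3v; rwa [Int.cast_natCast] at this
  obtain ⟨a, ha⟩ := exists_eq_zsmul_of_apply_frob_eq_zero K hℓG.place h𝔐 h3v' hℓG.valuation_natCast hF hgF hpT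
    fx.1 fy.1 hfx_add hfy_add hfxF hfyF (addOrderOf_eq_prime (hpT _) hQ0) hfI hram
  have hcl : oneCocycleClass ((DiscreteGaloisModule.toLocal ((W.baseChange K).torsionGaloisModule ((3 ^ 1 : ℕ) : ℤ))
      (Sum.inr hℓG.place)).toTopRep) fy = a • oneCocycleClass ((DiscreteGaloisModule.toLocal
        ((W.baseChange K).torsionGaloisModule ((3 ^ 1 : ℕ) : ℤ)) (Sum.inr hℓG.place)).toTopRep) fx := by
    have hfy_eq : fy = a • fx := Subtype.ext (ContinuousMap.ext fun g ↦ ha g)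
    rw [hfy_eq]
    exact map_zsmul (oneCocycleClassₗ ((DiscreteGaloisModule.toLocal ((W.baseChange K).torsionGaloisModule
      ((3 ^ 1 : ℕ) : ℤ)) (Sum.inr hℓG.place)).toTopRep)) a fx
  refine ⟨a, (hker _).mpr ?_⟩
  rw [hsub, sub_eq_zero, hlocy, hlocx]
  exact hcl

end Summit.BirchSwinnertonDyer.Rank1Residual.X11b.Three.Koly.Method2.KolyLocal

end
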